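import Literature.MathematicalPhysics.QuantumManyBody.CubicTrialVectorScalars
import HarnessLib

/-!
# The cubic sector of the trial functional: the main terms of `⟨𝒦⟩`, `⟨𝒞_N⟩`, `⟨𝒱_N^{(H)}⟩` in
# triple form (BCS 2021, Lemma 5.1)

Topic `Literature/MathematicalPhysics/QuantumManyBody`, namespace `BoseGas.Fock`; scalar evaluation of
the symbolic main terms left by `BogoliubovTrialEnergy.trialNumerator_cubicVector_le`, for the
provefact `Literature.MathematicalPhysics.QuantumManyBody.BoseGas.BastiCenatiempoSchlein2021_upperBound`.

* `arrSum_cubicCoeff_eq` — for a real even pair potential the symmetrised cubic coefficient of a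
  triple `τ = (u,a,b)` is `4(W_u+W_a)γ_uγ_aσ_b + 2·rest_τ`, where every term of `rest_τ` carries a
  Bogoliubov `σ` at a hard slot (the main term `𝒞_N` versus `F₁`–`F₃` of [ibid., §4]).
* `hardKernel_sum_of_b_eq` — two triples with the same soft slot interact through
  `γ_uγ_aγ_{u'}γ_{a'}[W(u'-u) + W(a'-u) + W(u'-a) + W(a'-a)]` ((5.13) of [ibid.]);
  `sum_triples_b_eq` — triples with a given soft slot versus ordered hard pairs.
* `cubicSector_identity` — the exact bookkeeping of Lemma 5.1 / Prop. 3.2: kinetic term of `ξ_ν`,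
  hard block and cubic block combine, through the scattering equation at the two hard modes of
  each triple, into the single term `L⁻³∑_τσ_b²(W_u+W_a)(η_u+η_a)` (`(1/N)∑σ_v²∑N^κV̂(r)(η_r+η_{r+v})`
  of Prop. 3.2, later cancelled against the quasi-free bookkeeping) plus the explicit corrections
  `R₁`–`R₄` (which [ibid.] bounds by `CN^{5κ/2}max{N^{-ε}, N^{12κ-7+5ε}}`).

## References

* [BastiCenatiempoSchlein2021] G. Basti, S. Cenatiempo, B. Schlein, Forum Math. Sigma 9 (2021) e74,
  arXiv:2101.06222: §4 (`𝒞_N`, `F₁`–`F₃`), Lemma 5.1, §5.2–5.4.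
-/

noncomputable section

namespace Literature.MathematicalPhysics.QuantumManyBody.BoseGas

open Complex MvPolynomial Finset
open scoped ComplexConjugate BigOperators

namespace Fock

variable {ι : Type*} [DecidableEq ι] [LinearOrder ι] {e : ι → Momentum} {PH PS : Finset ι}

section CubicCoefficient

omit [DecidableEq ι] in
/-- **The symmetrised cubic coefficient of a triple.** For `W` real (`conj W = W`) and even,
`arrSum (cubicCoeff e W γ σ) τ = 4(W(e u)+W(e a))γ_uγ_aσ_b + 2·rest_τ` with
`rest_τ = (W_b+W_a)γ_uσ_aσ_b + (W_b+W_u)γ_aσ_uσ_b + (W_a+W_b)γ_uσ_bσ_a + (W_u+W_b)γ_uγ_bσ_a`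
`+ (W_u+W_b)γ_aσ_bσ_u + (W_a+W_b)γ_aγ_bσ_u + (W_a+W_u)γ_bσ_uσ_a + (W_b+W_u)γ_bγ_uσ_a`
`+ (W_u+W_a)γ_bσ_aσ_u + (W_b+W_a)γ_bγ_aσ_u` (every term has a `σ` at a hard slot `u` or `a`).
The first term is the coefficient structure `N^κV̂(r)σ_{p+r}γ_pγ_r` of `𝒞_N`; the rest are the
`F₁`–`F₃`-type terms. [cite: BastiCenatiempoSchlein2021, §4 (`𝒞_N`, `F₁`, `F₂`, `F₃`), (3.?) Prop. 3.1] -/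
theorem arrSum_cubicCoeff_eq (W : Momentum → ℂ) (hWev : ∀ k, W (-k) = W k) (hWreal : ∀ k, conj (W k) = W k)
    (gm sg : ι → ℝ) (τ : Triple e PH PS) :
    arrSum (cubicCoeff e W gm sg) τ =
      4 * (W (e τ.u) + W (e τ.a)) * ((gm τ.u * gm τ.a * sg τ.b : ℝ) : ℂ) +
      2 * ((W (e τ.b) + W (e τ.a)) * ((gm τ.u * sg τ.a * sg τ.b : ℝ) : ℂ) +
            (W (e τ.b) + W (e τ.u)) * ((gm τ.a * sg τ.u * sg τ.b : ℝ) : ℂ) +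
            (W (e τ.a) + W (e τ.b)) * ((gm τ.u * sg τ.b * sg τ.a : ℝ) : ℂ) +
            (W (e τ.u) + W (e τ.b)) * ((gm τ.u * gm τ.b * sg τ.a : ℝ) : ℂ) +
            (W (e τ.u) + W (e τ.b)) * ((gm τ.a * sg τ.b * sg τ.u : ℝ) : ℂ) +
            (W (e τ.a) + W (e τ.b)) * ((gm τ.a * gm τ.b * sg τ.u : ℝ) : ℂ) +
            (W (e τ.a) + W (e τ.u)) * ((gm τ.b * sg τ.u * sg τ.a : ℝ) : ℂ) +
            (W (e τ.b) + W (e τ.u)) * ((gm τ.b * gm τ.u * sg τ.a : ℝ) : ℂ) +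
            (W (e τ.u) + W (e τ.a)) * ((gm τ.b * sg τ.a * sg τ.u : ℝ) : ℂ) +
            (W (e τ.b) + W (e τ.a)) * ((gm τ.b * gm τ.a * sg τ.u : ℝ) : ℂ)) := by
  have h0 := τ.prop.2.2.2.1
  -- the six momentum conditions
  have h1 : e τ.u + e τ.a + e τ.b = 0 := h0
  have h2 : e τ.a + e τ.u + e τ.b = 0 := by rw [← h0]; abel
  have h3 : e τ.u + e τ.b + e τ.a = 0 := by rw [← h0]; abel
  have h4 : e τ.a + e τ.b + e τ.u = 0 := by rw [← h0]; abel
  have h5 : e τ.b + e τ.u + e τ.a = 0 := by rw [← h0]; abel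
  have h6 : e τ.b + e τ.a + e τ.u = 0 := by rw [← h0]; abel
  unfold arrSum cubicCoeff
  rw [if_pos h1, if_pos h2, if_pos h3, if_pos h4, if_pos h5, if_pos h6]
  simp only [map_add, map_mul, Complex.conj_ofReal, hWreal, hWev]
  push_cast
  ring

omit [DecidableEq ι] in
/-- The real part version: for real `W` the symmetrised coefficient is real, and
`Re arrSum = 4(W_u+W_a)γ_uγ_aσ_b + 2·rest` with real `W`. [cite: BastiCenatiempoSchlein2021, §4] -/
theorem re_arrSum_cubicCoeff_eq (Wr : Momentum → ℝ) (hWev : ∀ k, Wr (-k) = Wr k)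
    (gm sg : ι → ℝ) (τ : Triple e PH PS) :
    (arrSum (cubicCoeff e (fun k => (Wr k : ℂ)) gm sg) τ).re =
      4 * (Wr (e τ.u) + Wr (e τ.a)) * (gm τ.u * gm τ.a * sg τ.b) +
      2 * ((Wr (e τ.b) + Wr (e τ.a)) * (gm τ.u * sg τ.a * sg τ.b) +
            (Wr (e τ.b) + Wr (e τ.u)) * (gm τ.a * sg τ.u * sg τ.b) +
            (Wr (e τ.a) + Wr (e τ.b)) * (gm τ.u * sg τ.b * sg τ.a) +
            (Wr (e τ.u) + Wr (e τ.b)) * (gm τ.u * gm τ.b * sg τ.a) +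
            (Wr (e τ.u) + Wr (e τ.b)) * (gm τ.a * sg τ.b * sg τ.u) +
            (Wr (e τ.a) + Wr (e τ.b)) * (gm τ.a * gm τ.b * sg τ.u) +
            (Wr (e τ.a) + Wr (e τ.u)) * (gm τ.b * sg τ.u * sg τ.a) +
            (Wr (e τ.b) + Wr (e τ.u)) * (gm τ.b * gm τ.u * sg τ.a) +
            (Wr (e τ.u) + Wr (e τ.a)) * (gm τ.b * sg τ.a * sg τ.u) +
            (Wr (e τ.b) + Wr (e τ.a)) * (gm τ.b * gm τ.a * sg τ.u)) := by
  rw [arrSum_cubicCoeff_eq (fun k => (Wr k : ℂ)) (fun k => by simp [hWev]) (fun k => Complex.conj_ofReal _) gm sg τ]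
  simp only [Complex.add_re, Complex.mul_re, Complex.ofReal_re, Complex.ofReal_im, Complex.re_ofNat,
    Complex.im_ofNat, mul_zero, sub_zero, zero_mul, Complex.add_im]

end CubicCoefficient

/-! ### The hard kernel between two triples with the same soft slot -/

section HardKernel

omit [LinearOrder ι] in
/-- On hard modes with conserved momentum the hard kernel is `W(e x' - e x)γ_yγ_xγ_{y'}γ_{x'}`.
[cite: BastiCenatiempoSchlein2021, §5.3 (5.12)] -/
theorem hardKernel_of_mem (W : Momentum → ℂ) (gm : ι → ℝ) {x y x' y' : ι} (hx : x ∈ PH) (hy : y ∈ PH)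
    (hx' : x' ∈ PH) (hy' : y' ∈ PH) (hmom : e x + e y = e x' + e y') :
    hardKernel e W gm PH x y x' y' = W (e x' - e x) * ((gm y * gm x * (gm y' * gm x') : ℝ) : ℂ) := by
  unfold hardKernel pairCoeff'
  rw [if_pos ⟨hx, hy, hx', hy'⟩, if_pos hmom]

/-- **The kernel `K̃(τ,τ')` of two triples sharing the soft slot**:
`K̃ = γ_uγ_aγ_{u'}γ_{a'}[W(u'-u) + W(a'-u) + W(u'-a) + W(a'-a)]`.
[cite: BastiCenatiempoSchlein2021, §5.3 (5.13)] -/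
theorem hardKernel_sum_of_b_eq (W : Momentum → ℂ) (gm : ι → ℝ) {τ τ' : Triple e PH PS} (hb : τ.b = τ'.b) :
    hardKernel e W gm PH τ.u τ.a τ'.u τ'.a + hardKernel e W gm PH τ.u τ.a τ'.a τ'.u +
        hardKernel e W gm PH τ.a τ.u τ'.u τ'.a + hardKernel e W gm PH τ.a τ.u τ'.a τ'.u =
      ((gm τ.u * gm τ.a * (gm τ'.u * gm τ'.a) : ℝ) : ℂ) *
        (W (e τ'.u - e τ.u) + W (e τ'.a - e τ.u) + W (e τ'.u - e τ.a) + W (e τ'.a - e τ.a)) := by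
  have hu : τ.u ∈ PH := τ.prop.1
  have ha : τ.a ∈ PH := τ.prop.2.1
  have hu' : τ'.u ∈ PH := τ'.prop.1
  have ha' : τ'.a ∈ PH := τ'.prop.2.1
  have hm : e τ.u + e τ.a + e τ.b = 0 := τ.prop.2.2.2.1
  have hm' : e τ'.u + e τ'.a + e τ'.b = 0 := τ'.prop.2.2.2.1
  have hmom : e τ.u + e τ.a = e τ'.u + e τ'.a := by
    have h1 : e τ.u + e τ.a = -e τ.b := eq_neg_of_add_eq_zero_left hm
    have h2 : e τ'.u + e τ'.a = -e τ'.b := eq_neg_of_add_eq_zero_left hm'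
    rw [h1, h2, hb]
  rw [hardKernel_of_mem W gm hu ha hu' ha' hmom,
    hardKernel_of_mem W gm hu ha ha' hu' (by rw [hmom, add_comm]),
    hardKernel_of_mem W gm ha hu hu' ha' (by rw [← hmom, add_comm]),
    hardKernel_of_mem W gm ha hu ha' hu' (by rw [add_comm, hmom, add_comm])]
  push_cast
  ring

end HardKernel

/-! ### Sums over the triples with a given soft slot -/

section SoftSlot

variable [Fintype ι]

/-- **Triples with soft slot `b` ↔ ordered hard pairs**: for `F` symmetric,
`∑_{τ: b(τ)=b} F(u,a) = ½ ∑_{x,y ∈ P_H, x ≠ y, e x+e y+e b=0} F(x,y)` (`b ∈ P_S`).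
[cite: BastiCenatiempoSchlein2021, (2.12) (the pairs `(r, v)` and `(-r-v, v)` create the same modes)] -/
theorem sum_triples_b_eq (b : ι) (hb : b ∈ PS) (F : ι → ι → ℂ) (hF : ∀ x y, F x y = F y x) :
    ∑ τ : Triple e PH PS, (if τ.b = b then F τ.u τ.a else 0) =
      (∑ x ∈ PH, ∑ y ∈ PH, (if e x + e y + e b = 0 ∧ x ≠ y then F x y else 0)) / 2 := by
  classical
  -- the subtype sum as a filtered sum over `ι × ι × ι`
  have h1 : ∑ τ : Triple e PH PS, (if τ.b = b then F τ.u τ.a else 0) =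
      ∑ t ∈ (Finset.univ : Finset (ι × ι × ι)).filter (IsTriple e PH PS),
        (if t.2.2 = b then F t.1 t.2.1 else 0) :=
    (Finset.sum_subtype (p := IsTriple e PH PS) ((Finset.univ : Finset (ι × ι × ι)).filter (IsTriple e PH PS))
      (fun t => by simp) (fun t => if t.2.2 = b then F t.1 t.2.1 else 0)).symm
  rw [h1, Finset.sum_filter, Fintype.sum_prod_type]
  simp only [Fintype.sum_prod_type]
  -- the innermost sum picks `w = b`
  have hinner : ∀ x y : ι, ∑ w, (if IsTriple e PH PS (x, y, w) then (if (x, y, w).2.2 = b then F (x, y, w).1 (x, y, w).2.1 else 0)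
      else 0) = if x ∈ PH ∧ y ∈ PH ∧ e x + e y + e b = 0 ∧ x < y then F x y else 0 := by
    intro x y
    have hsw : ∀ w, (if IsTriple e PH PS (x, y, w) then (if (x, y, w).2.2 = b then F (x, y, w).1 (x, y, w).2.1 else 0) else 0) =
        if w = b then (if IsTriple e PH PS (x, y, w) then F x y else 0) else 0 := by
      intro w
      by_cases hw : w = b
      · simp only [hw, if_true]
      · simp only [hw, if_false]; split_ifs <;> rfl
    simp only [hsw, Finset.sum_ite_eq', Finset.mem_univ, if_true]
    unfold IsTriple
    simp only [hb, true_and]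
  simp only [hinner]
  -- restrict to `P_H × P_H`
  have hmem : ∀ (G : ι → ℂ), ∑ x, (if x ∈ PH then G x else 0) = ∑ x ∈ PH, G x := fun G => by
    rw [← Finset.sum_filter]; congr 1; ext x; simp
  have hxy : ∀ x y, (if x ∈ PH ∧ y ∈ PH ∧ e x + e y + e b = 0 ∧ x < y then F x y else 0) =
      if x ∈ PH then (if y ∈ PH then (if e x + e y + e b = 0 ∧ x < y then F x y else 0) else 0) else 0 := by
    intro x y; simp only [ite_and]
  simp only [hxy, Finset.sum_ite_irrel, Finset.sum_const_zero]
  rw [hmem]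
  rw [Finset.sum_congr rfl fun x _ => hmem (fun y => if e x + e y + e b = 0 ∧ x < y then F x y else 0)]
  -- symmetrise `x < y` into `x ≠ y`
  have hsplit : ∀ x y, (if e x + e y + e b = 0 ∧ x ≠ y then F x y else 0) =
      (if e x + e y + e b = 0 ∧ x < y then F x y else 0) + (if e y + e x + e b = 0 ∧ y < x then F y x else 0) := by
    intro x y
    rcases lt_trichotomy x y with h | h | h
    · by_cases hm : e x + e y + e b = 0
      · rw [if_pos ⟨hm, h.ne⟩, if_pos ⟨hm, h⟩, if_neg (fun h' => absurd h'.2 (not_lt.2 h.le)), add_zero]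
      · rw [if_neg (fun h' => hm h'.1), if_neg (fun h' => hm h'.1), if_neg (fun h' => absurd h'.2 (not_lt.2 h.le)),
          add_zero]
    · subst h; simp
    · by_cases hm : e x + e y + e b = 0
      · have hm' : e y + e x + e b = 0 := by rw [add_comm (e y) (e x)]; exact hm
        rw [if_pos ⟨hm, h.ne'⟩, if_neg (fun h' => absurd h'.2 (not_lt.2 h.le)), if_pos ⟨hm', h⟩, zero_add]
        exact hF x y
      · have hm' : ¬ (e y + e x + e b = 0) := by rwa [add_comm (e y) (e x)]
        rw [if_neg (fun h' => hm h'.1), if_neg (fun h' => absurd h'.2 (not_lt.2 h.le)), if_neg (fun h' => hm' h'.1),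
          add_zero]
  have hsym : ∑ x ∈ PH, ∑ y ∈ PH, (if e x + e y + e b = 0 ∧ x ≠ y then F x y else 0) =
      2 * ∑ x ∈ PH, ∑ y ∈ PH, (if e x + e y + e b = 0 ∧ x < y then F x y else 0) := by
    simp only [hsplit, Finset.sum_add_distrib]
    rw [two_mul]
    congr 1
    exact Finset.sum_comm
  rw [hsym]
  ring

end SoftSlot

/-! ### The cubic sector combined with the scattering equation -/

section Combination

variable [Fintype ι]

/-- **The cubic sector of the trial functional, combined with the scattering equation**
(Lemma 5.1 and the proof of Prop. 3.2 of [ibid.], main terms; all corrections kept explicit).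
With the real cubic amplitude `κ_τ = (η_u + η_a)σ_b/√N`, a real even pair potential `W`, Bogoliubov
amplitudes `γ = gm`, `σ = sb`, `Q_τ = N⁻¹σ_b²(η_u+η_a)`, `ρ̃ = N/L³`, the three symbolic main
terms of `BogoliubovTrialEnergy.trialNumerator_cubicVector_le` satisfy the identity
`∑_τ w̃_τ|κ_τ|² + [Re 𝒱_H-sum + √N₀ Re 𝒞-sum]/(2L³) = L⁻³∑_τ σ_b²(W_u+W_a)(η_u+η_a)` (the term
`(1/N)∑σ_v²∑N^κV̂(r)(η_r+η_{r+v})` of Prop. 3.2) `+ ∑_τ Q_τ[EL_u + EL_a] + R₁ + R₂ + R₃ + R₄`, where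
`EL_p = 2ε_pη_p + ρ̃W_p + L⁻³∑_q W(e p - e q)η_q` vanishes by the exact scattering equation and
`R₁ = ∑Q·2ρ̃(W_u+W_a)(√N₀γ_uγ_a/√N - 1)`, `R₂` = the kinetic cross terms `(ε_a+ε_b-ε_u)η_u + …`
and the `γ²+σ²-1` corrections, `R₃` = the hard block minus the full convolution
`∑Q L⁻³(∑_qW(u-q)η_q + ∑_qW(a-q)η_q)`, `R₄` = the `F₁`–`F₃`-type rest of the cubic coefficient.
[cite: BastiCenatiempoSchlein2021, Lemma 5.1, proof of Prop. 3.2 (§5, first page), §5.4] -/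
theorem cubicSector_identity (Wr : Momentum → ℝ) (hWev : ∀ k, Wr (-k) = Wr k) (gm sb η ε : ι → ℝ)
    {N N₀ L : ℝ} (hN : 0 < N) (hL : 0 < L) (κ : Triple e PH PS → ℂ)
    (hκ : ∀ τ : Triple e PH PS, κ τ = (((η τ.u + η τ.a) * sb τ.b / Real.sqrt N : ℝ) : ℂ)) :
    (∑ τ : Triple e PH PS, (ε τ.u * (gm τ.u ^ 2 + sb τ.u ^ 2) + ε τ.a * (gm τ.a ^ 2 + sb τ.a ^ 2) +
        ε τ.b * (gm τ.b ^ 2 + sb τ.b ^ 2)) * ‖κ τ‖ ^ 2) +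
      ((∑ τ' : Triple e PH PS, ∑ τ : Triple e PH PS, (if τ.b = τ'.b then
          κ τ' * conj (κ τ) * (hardKernel e (fun k => (Wr k : ℂ)) gm PH τ.u τ.a τ'.u τ'.a +
            hardKernel e (fun k => (Wr k : ℂ)) gm PH τ.u τ.a τ'.a τ'.u +
            hardKernel e (fun k => (Wr k : ℂ)) gm PH τ.a τ.u τ'.u τ'.a +
            hardKernel e (fun k => (Wr k : ℂ)) gm PH τ.a τ.u τ'.a τ'.u) else 0)).re +
        Real.sqrt N₀ * (∑ τ : Triple e PH PS, arrSum (cubicCoeff e (fun k => (Wr k : ℂ)) gm sb) τ * conj (κ τ)).re) /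
        (2 * L ^ 3) =
      -- `X_c`: the term of Prop. 3.2
      (L ^ 3)⁻¹ * ∑ τ : Triple e PH PS, sb τ.b ^ 2 * (Wr (e τ.u) + Wr (e τ.a)) * (η τ.u + η τ.a) +
      -- the scattering-equation brackets at the two hard modes (zero by the exact equation)
      (∑ τ : Triple e PH PS, N⁻¹ * sb τ.b ^ 2 * (η τ.u + η τ.a) *
        ((2 * ε τ.u * η τ.u + N / L ^ 3 * Wr (e τ.u) + (L ^ 3)⁻¹ * ∑ q, Wr (e τ.u - e q) * η q) +
          (2 * ε τ.a * η τ.a + N / L ^ 3 * Wr (e τ.a) + (L ^ 3)⁻¹ * ∑ q, Wr (e τ.a - e q) * η q))) +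
      -- `R₁`
      (∑ τ : Triple e PH PS, N⁻¹ * sb τ.b ^ 2 * (η τ.u + η τ.a) *
        (2 * (N / L ^ 3) * (Wr (e τ.u) + Wr (e τ.a)) * (Real.sqrt N₀ * (gm τ.u * gm τ.a) / Real.sqrt N - 1))) +
      -- `R₂`
      (∑ τ : Triple e PH PS, N⁻¹ * sb τ.b ^ 2 * (η τ.u + η τ.a) *
          ((ε τ.a + ε τ.b - ε τ.u) * η τ.u + (ε τ.u + ε τ.b - ε τ.a) * η τ.a) +
        ∑ τ : Triple e PH PS, N⁻¹ * (η τ.u + η τ.a) ^ 2 * sb τ.b ^ 2 *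
          (ε τ.u * (gm τ.u ^ 2 + sb τ.u ^ 2 - 1) + ε τ.a * (gm τ.a ^ 2 + sb τ.a ^ 2 - 1) +
            ε τ.b * (gm τ.b ^ 2 + sb τ.b ^ 2 - 1))) +
      -- `R₃`
      ((∑ τ' : Triple e PH PS, ∑ τ : Triple e PH PS, (if τ.b = τ'.b then
          κ τ' * conj (κ τ) * (hardKernel e (fun k => (Wr k : ℂ)) gm PH τ.u τ.a τ'.u τ'.a +
            hardKernel e (fun k => (Wr k : ℂ)) gm PH τ.u τ.a τ'.a τ'.u +
            hardKernel e (fun k => (Wr k : ℂ)) gm PH τ.a τ.u τ'.u τ'.a +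
            hardKernel e (fun k => (Wr k : ℂ)) gm PH τ.a τ.u τ'.a τ'.u) else 0)).re / (2 * L ^ 3) -
        ∑ τ : Triple e PH PS, N⁻¹ * sb τ.b ^ 2 * (η τ.u + η τ.a) *
          ((L ^ 3)⁻¹ * ((∑ q, Wr (e τ.u - e q) * η q) + ∑ q, Wr (e τ.a - e q) * η q))) +
      -- `R₄`
      Real.sqrt N₀ * (∑ τ : Triple e PH PS,
        2 * ((Wr (e τ.b) + Wr (e τ.a)) * (gm τ.u * sb τ.a * sb τ.b) +
            (Wr (e τ.b) + Wr (e τ.u)) * (gm τ.a * sb τ.u * sb τ.b) +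
            (Wr (e τ.a) + Wr (e τ.b)) * (gm τ.u * sb τ.b * sb τ.a) +
            (Wr (e τ.u) + Wr (e τ.b)) * (gm τ.u * gm τ.b * sb τ.a) +
            (Wr (e τ.u) + Wr (e τ.b)) * (gm τ.a * sb τ.b * sb τ.u) +
            (Wr (e τ.a) + Wr (e τ.b)) * (gm τ.a * gm τ.b * sb τ.u) +
            (Wr (e τ.a) + Wr (e τ.u)) * (gm τ.b * sb τ.u * sb τ.a) +
            (Wr (e τ.b) + Wr (e τ.u)) * (gm τ.b * gm τ.u * sb τ.a) +
            (Wr (e τ.u) + Wr (e τ.a)) * (gm τ.b * sb τ.a * sb τ.u) +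
            (Wr (e τ.b) + Wr (e τ.a)) * (gm τ.b * gm τ.a * sb τ.u)) *
          ((η τ.u + η τ.a) * sb τ.b / Real.sqrt N)) / (2 * L ^ 3) := by
  have hsN : 0 < Real.sqrt N := Real.sqrt_pos.2 hN
  have hsN2 : Real.sqrt N ^ 2 = N := Real.sq_sqrt hN.le
  have hL3 : L ^ 3 ≠ 0 := by positivity
  -- real values of `‖κ‖²` and of the cubic pairing
  set κr : Triple e PH PS → ℝ := fun τ => (η τ.u + η τ.a) * sb τ.b / Real.sqrt N with hκr
  have hκ' : ∀ τ, κ τ = ((κr τ : ℝ) : ℂ) := fun τ => by rw [hκ τ]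
  have hnorm : ∀ τ, ‖κ τ‖ ^ 2 = κr τ ^ 2 := fun τ => by rw [hκ' τ, Complex.norm_real, Real.norm_eq_abs, sq_abs]
  have hMC : (∑ τ : Triple e PH PS, arrSum (cubicCoeff e (fun k => (Wr k : ℂ)) gm sb) τ * conj (κ τ)).re =
      ∑ τ : Triple e PH PS, (4 * (Wr (e τ.u) + Wr (e τ.a)) * (gm τ.u * gm τ.a * sb τ.b) +
        2 * ((Wr (e τ.b) + Wr (e τ.a)) * (gm τ.u * sb τ.a * sb τ.b) +
            (Wr (e τ.b) + Wr (e τ.u)) * (gm τ.a * sb τ.u * sb τ.b) +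
            (Wr (e τ.a) + Wr (e τ.b)) * (gm τ.u * sb τ.b * sb τ.a) +
            (Wr (e τ.u) + Wr (e τ.b)) * (gm τ.u * gm τ.b * sb τ.a) +
            (Wr (e τ.u) + Wr (e τ.b)) * (gm τ.a * sb τ.b * sb τ.u) +
            (Wr (e τ.a) + Wr (e τ.b)) * (gm τ.a * gm τ.b * sb τ.u) +
            (Wr (e τ.a) + Wr (e τ.u)) * (gm τ.b * sb τ.u * sb τ.a) +
            (Wr (e τ.b) + Wr (e τ.u)) * (gm τ.b * gm τ.u * sb τ.a) +
            (Wr (e τ.u) + Wr (e τ.a)) * (gm τ.b * sb τ.a * sb τ.u) +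
            (Wr (e τ.b) + Wr (e τ.a)) * (gm τ.b * gm τ.a * sb τ.u))) * κr τ := by
    rw [Complex.re_sum]
    refine Finset.sum_congr rfl fun τ _ => ?_
    rw [hκ' τ, Complex.conj_ofReal, Complex.re_mul_ofReal, re_arrSum_cubicCoeff_eq Wr hWev gm sb τ]
  simp only [hnorm]
  rw [hMC]
  -- everything is now a real identity, summand by summand
  set r := Real.sqrt N with hr
  have hpt : ∀ τ : Triple e PH PS,
      (ε τ.u * (gm τ.u ^ 2 + sb τ.u ^ 2) + ε τ.a * (gm τ.a ^ 2 + sb τ.a ^ 2) + ε τ.b * (gm τ.b ^ 2 + sb τ.b ^ 2)) * κr τ ^ 2 +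
        Real.sqrt N₀ * ((4 * (Wr (e τ.u) + Wr (e τ.a)) * (gm τ.u * gm τ.a * sb τ.b)) * κr τ) / (2 * L ^ 3) +
        N⁻¹ * sb τ.b ^ 2 * (η τ.u + η τ.a) * ((L ^ 3)⁻¹ * ((∑ q, Wr (e τ.u - e q) * η q) + ∑ q, Wr (e τ.a - e q) * η q)) =
      (L ^ 3)⁻¹ * (sb τ.b ^ 2 * (Wr (e τ.u) + Wr (e τ.a)) * (η τ.u + η τ.a)) +
        N⁻¹ * sb τ.b ^ 2 * (η τ.u + η τ.a) *
          ((2 * ε τ.u * η τ.u + N / L ^ 3 * Wr (e τ.u) + (L ^ 3)⁻¹ * ∑ q, Wr (e τ.u - e q) * η q) +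
            (2 * ε τ.a * η τ.a + N / L ^ 3 * Wr (e τ.a) + (L ^ 3)⁻¹ * ∑ q, Wr (e τ.a - e q) * η q)) +
        N⁻¹ * sb τ.b ^ 2 * (η τ.u + η τ.a) *
          (2 * (N / L ^ 3) * (Wr (e τ.u) + Wr (e τ.a)) * (Real.sqrt N₀ * (gm τ.u * gm τ.a) / r - 1)) +
        (N⁻¹ * sb τ.b ^ 2 * (η τ.u + η τ.a) * ((ε τ.a + ε τ.b - ε τ.u) * η τ.u + (ε τ.u + ε τ.b - ε τ.a) * η τ.a) +
          N⁻¹ * (η τ.u + η τ.a) ^ 2 * sb τ.b ^ 2 *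
            (ε τ.u * (gm τ.u ^ 2 + sb τ.u ^ 2 - 1) + ε τ.a * (gm τ.a ^ 2 + sb τ.a ^ 2 - 1) +
              ε τ.b * (gm τ.b ^ 2 + sb τ.b ^ 2 - 1))) := by
    intro τ
    simp only [hκr]
    rw [← hsN2]
    field_simp
    ring
  -- sum the pointwise identity
  have hsum := Finset.sum_congr rfl fun (τ : Triple e PH PS) (_ : τ ∈ Finset.univ) => hpt τ
  simp only [Finset.sum_add_distrib] at hsum
  -- split the `𝒞`-sum into main and rest
  have hCsplit : ∑ τ : Triple e PH PS, (4 * (Wr (e τ.u) + Wr (e τ.a)) * (gm τ.u * gm τ.a * sb τ.b) +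
        2 * ((Wr (e τ.b) + Wr (e τ.a)) * (gm τ.u * sb τ.a * sb τ.b) +
            (Wr (e τ.b) + Wr (e τ.u)) * (gm τ.a * sb τ.u * sb τ.b) +
            (Wr (e τ.a) + Wr (e τ.b)) * (gm τ.u * sb τ.b * sb τ.a) +
            (Wr (e τ.u) + Wr (e τ.b)) * (gm τ.u * gm τ.b * sb τ.a) +
            (Wr (e τ.u) + Wr (e τ.b)) * (gm τ.a * sb τ.b * sb τ.u) +
            (Wr (e τ.a) + Wr (e τ.b)) * (gm τ.a * gm τ.b * sb τ.u) +
            (Wr (e τ.a) + Wr (e τ.u)) * (gm τ.b * sb τ.u * sb τ.a) +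
            (Wr (e τ.b) + Wr (e τ.u)) * (gm τ.b * gm τ.u * sb τ.a) +
            (Wr (e τ.u) + Wr (e τ.a)) * (gm τ.b * sb τ.a * sb τ.u) +
            (Wr (e τ.b) + Wr (e τ.a)) * (gm τ.b * gm τ.a * sb τ.u))) * κr τ =
      ∑ τ : Triple e PH PS, (4 * (Wr (e τ.u) + Wr (e τ.a)) * (gm τ.u * gm τ.a * sb τ.b)) * κr τ +
      ∑ τ : Triple e PH PS, 2 * ((Wr (e τ.b) + Wr (e τ.a)) * (gm τ.u * sb τ.a * sb τ.b) +
            (Wr (e τ.b) + Wr (e τ.u)) * (gm τ.a * sb τ.u * sb τ.b) +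
            (Wr (e τ.a) + Wr (e τ.b)) * (gm τ.u * sb τ.b * sb τ.a) +
            (Wr (e τ.u) + Wr (e τ.b)) * (gm τ.u * gm τ.b * sb τ.a) +
            (Wr (e τ.u) + Wr (e τ.b)) * (gm τ.a * sb τ.b * sb τ.u) +
            (Wr (e τ.a) + Wr (e τ.b)) * (gm τ.a * gm τ.b * sb τ.u) +
            (Wr (e τ.a) + Wr (e τ.u)) * (gm τ.b * sb τ.u * sb τ.a) +
            (Wr (e τ.b) + Wr (e τ.u)) * (gm τ.b * gm τ.u * sb τ.a) +
            (Wr (e τ.u) + Wr (e τ.a)) * (gm τ.b * sb τ.a * sb τ.u) +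
            (Wr (e τ.b) + Wr (e τ.a)) * (gm τ.b * gm τ.a * sb τ.u)) * ((η τ.u + η τ.a) * sb τ.b / r) := by
    rw [← Finset.sum_add_distrib]
    refine Finset.sum_congr rfl fun τ _ => ?_
    simp only [hκr]; ring
  rw [hCsplit]
  -- distribute the constants over the sums in `hsum`
  have hdiv : ∀ τ : Triple e PH PS, Real.sqrt N₀ * ((4 * (Wr (e τ.u) + Wr (e τ.a)) * (gm τ.u * gm τ.a * sb τ.b)) * κr τ) / (2 * L ^ 3) =
      (Real.sqrt N₀ / (2 * L ^ 3)) * ((4 * (Wr (e τ.u) + Wr (e τ.a)) * (gm τ.u * gm τ.a * sb τ.b)) * κr τ) := by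
    intro τ; ring
  simp only [hdiv, ← Finset.mul_sum] at hsum
  linear_combination hsum

end Combination

end Fock

end Literature.MathematicalPhysics.QuantumManyBody.BoseGas

end
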